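import Literature.Computability.Complexity.YatesMachineTables
import HarnessLib

/-!
# The evaluation machine of Williams' Lemma 4.2, III: the zeta rounds

Literature / circuit complexity, continuing `YatesMachineTables.lean`. After Phase 3 the
multiplicity table `fTable S` sits on `L` as `2ⁿ` words of width `b` in the order of the
numbers `T < 2ⁿ`. Phase 4 performs the `n` rounds of Yates' algorithm (Williams 2014, Lemma 4.2,
Proof 2: "`g_i(T) = g_{i-1}(T) + g_{i-1}(T ∖ {i})` for `i ∈ T`"), each round BLOCKWISE as a
machine with sequential access must (`YatesTables.blockRound`): the table is streamed in
chunks of `2 · 2ʲ` words; the lower half of a chunk is emitted and buffered (as a reversed code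
on `o`, made forward on `B2` by one pour), then replayed against the upper half with the word
adder `addWords` (`StackWords.lean`).

* specification: `blockRoundW` (the round on words, `addW = addBits · · false`) and
  **`blockRoundW_map`** (on the words of a table of numbers it computes the words of
  `blockRound` — fixed-width addition is addition modulo `2ᵇ` and the words only see
  residues), `blockRoundW_snoc`, `chunks`/`flatMap_chunks`;
* machine: `halfBody₀`/`runs_lowerLoop`, `halfBody₁`/`runs_upperLoop`, `pairBody` /
  **`runs_pairBody`** (a chunk `B ++ U` emits `B ++ zipWith addW U B`; cost `pairCost k b =
  k (72 b + 62) + 5`), `roundProg` / **`runs_roundProg`** (stream over the chunks,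
  `L := encList (blockRoundW k m W)`), `runs_zetaLoop` (round `j` turns `gTable S j` into
  `gTable S (j+1)`, block counter doubling) and `zetaProg` / **`runs_zetaProg`**: from the
  multiplicity table to `gTable S n` — entry `T` = number of terms true at the `T`-th
  assignment (`getD_gTable_n`) — within `zetaCost n b = O(n 2ⁿ b)` steps.

## References

* R. Williams, *Nonuniform ACC circuit lower bounds*, J. ACM 61(1) (2014) 2:1–2:32, Lemma 4.2,
  Proof 2 (Yates' dynamic programming) and App. C (tape implementation) [Williams2014].
* F. Yates, *The Design and Analysis of Factorial Experiments*, 1937; D. E. Knuth, TAOCP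
  Vol. 2, §4.6.4.
-/

namespace Literature.Computability.Complexity

open SProg Com _root_.Computability Finset

namespace YatesM

open RRF YRF

/-! ### Specification: the blockwise round on words -/

/-- Word addition of two `b`-bit words (modulo `2ᵇ`). [folklore] -/
def addW (u v : List Bool) : List Bool := addBits u v false

/-- The blockwise round on a table of words (`k` = half-chunk, `m` chunks): lower halves kept,
added entrywise onto the upper halves. [cite: Williams2014, Lemma 4.2 (Proof 2)] -/
def blockRoundW (k : ℕ) : ℕ → List (List Bool) → List (List Bool)
  | 0, _ => []
  | m + 1, l => (l.take k ++ List.zipWith addW ((l.drop k).take k) (l.take k)) ++ blockRoundW k m (l.drop (2 * k))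

/-- **The word round is the number round**: on the words of a table of numbers, `blockRoundW`
computes the words of `blockRound` (addition of `b`-bit words is addition modulo `2ᵇ`, and
`natToWord b` only sees residues). [folklore] -/
theorem blockRoundW_map (b k : ℕ) : ∀ (m : ℕ) (tbl : List ℕ),
    blockRoundW k m (tbl.map (natToWord b)) = (blockRound k m tbl).map (natToWord b)
  | 0, tbl => rfl
  | m + 1, tbl => by
    rw [blockRoundW, blockRound, List.map_append, List.map_append, ← List.map_drop, ← List.map_take,
      ← List.map_drop, ← List.map_take, blockRoundW_map b k m]
    congr 2
    generalize (tbl.drop k).take k = U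
    generalize tbl.take k = B
    induction U generalizing B with
    | nil => simp
    | cons u U ih =>
      cases B with
      | nil => simp
      | cons v B => simp [ih, addW, addBits_natToWord]

/-! ### Phase 4: one block pair -/

/-- Lower-half entry: read it, copy it, emit it onto the output `z` and onto the half-block
buffer `o`, park a block token. [folklore] -/
def halfBody₀ : Com YReg :=
  readItemTo iL iA iw it ;; copy iA oC it ip ;; emit iA iz ;; emit oC io ;; push oBlk2 true

/-- Effect of `halfBody₀`: `29 |v| + 19` steps. [folklore] -/
theorem runs_halfBody₀ (v rest : List Bool) (ρ : RRF) (σ : YRF) (hL : ρ.L = dbl v ++ false :: true :: rest)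
    (hA : ρ.A = []) (hw : ρ.w = []) (ht : ρ.t = []) (hp : ρ.p = []) (hC : σ.C = []) :
    Runs halfBody₀ (est ρ σ) (est { ρ with
        L := rest
        z := true :: false :: ((dbl v).reverse ++ ρ.z)
        o := true :: false :: ((dbl v).reverse ++ ρ.o) } { σ with blk2 := true :: σ.blk2 })
      (29 * v.length + 19) := by
  set ρ₁ : RRF := { ρ with L := rest, A := v } with hρ₁
  have h1 : Runs (readItemTo iL iA iw it) (est ρ σ) (est ρ₁ σ) (11 * v.length + 9) := by
    have h := runs_readItemTo (L := iL) (A := iA) (w := iw) (t := it) (by decide) (by decide) (by decide)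
      (by decide) (by decide) v rest (est ρ σ) (by simp [hL]) (by simp [hw]) (by simp [ht])
    refine h.of_eq ?_ le_rfl
    simp only [hρ₁]; simp [hA]
  set σ₂ : YRF := { σ with C := v } with hσ₂
  have h2 : Runs (copy iA oC it ip) (est ρ₁ σ) (est ρ₁ σ₂) (10 * v.length + 3) := by
    have h := runs_copy (a := iA) (b := oC) (t := it) (u := ip) (by decide) (by decide) (by decide)
      (by decide) (by decide) (by decide) (est ρ₁ σ) (by simp [hρ₁, ht]) (by simp [hρ₁, hp])
    refine h.of_eq ?_ (by simp [hρ₁])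
    simp only [hσ₂, hρ₁]; simp [hC]
  set ρ₃ : RRF := { ρ₁ with A := [], z := true :: false :: ((dbl v).reverse ++ ρ.z) } with hρ₃
  have h3 : Runs (emit iA iz) (est ρ₁ σ₂) (est ρ₃ σ₂) (4 * v.length + 3) := by
    have h := runs_emit (h := iA) (o := iz) (by decide) (est ρ₁ σ₂)
    rw [show (est ρ₁ σ₂ iA).length = v.length by simp [hρ₁]] at h
    refine h.of_eq ?_ le_rfl
    simp only [hρ₃, hρ₁]; simp [dbl]
  set ρ₄ : RRF := { ρ₃ with o := true :: false :: ((dbl v).reverse ++ ρ.o) } with hρ₄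
  set σ₄ : YRF := { σ with C := [] } with hσ₄
  have h4 : Runs (emit oC io) (est ρ₃ σ₂) (est ρ₄ σ₄) (4 * v.length + 3) := by
    have h := runs_emit (h := oC) (o := io) (by decide) (est ρ₃ σ₂)
    rw [show (est ρ₃ σ₂ oC).length = v.length by simp [hσ₂]] at h
    refine h.of_eq ?_ le_rfl
    simp only [hρ₄, hρ₃, hρ₁, hσ₄, hσ₂]; simp [dbl]
  set σ₅ : YRF := { σ with blk2 := true :: σ.blk2 } with hσ₅
  have h5 : Runs (push oBlk2 true) (est ρ₄ σ₄) (est ρ₄ σ₅) 1 :=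
    Runs.push' (by simp only [hσ₅, hσ₄]; obtain ⟨⟩ := σ; simp only at hC ⊢; simp [hC])
  exact (h1.seq (h2.seq (h3.seq (h4.seq h5)))).of_eq (by simp only [hρ₄, hρ₃, hρ₁, hσ₅, hA]) (by omega)

/-- The lower half: per block token one `halfBody₀`. [folklore] -/
theorem runs_lowerLoop (b : ℕ) : ∀ (B R Ez Eo : List (List Bool)) (ρ : RRF) (σ : YRF),
    ρ.L = encList (B ++ R) → (∀ v ∈ B, v.length = b) → ρ.A = [] → ρ.w = [] → ρ.t = [] → ρ.p = [] →
    σ.C = [] → ρ.z = outRev Ez → ρ.o = outRev Eo → σ.blk = List.replicate B.length true →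
    Runs (countLoop oBlk halfBody₀) (est ρ σ) (est { ρ with
        L := encList R, z := outRev (Ez ++ B), o := outRev (Eo ++ B) }
        { σ with blk := [], blk2 := List.replicate B.length true ++ σ.blk2 })
      (B.length * (29 * b + 21) + 1)
  | [], R, Ez, Eo, ρ, σ, hL, hlen, hA, hw, ht, hp, hC, hz, ho, hblk => by
    refine (Runs.loop_nil _ _ (by simpa using hblk)).of_eq ?_ (by simp)
    obtain ⟨⟩ := ρ; obtain ⟨⟩ := σ; simp only at hL hz ho hblk ⊢; simp [hL, hz, ho, hblk]
  | v :: B, R, Ez, Eo, ρ, σ, hL, hlen, hA, hw, ht, hp, hC, hz, ho, hblk => by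
    have hk : est ρ σ oBlk = true :: List.replicate B.length true := by simp [hblk, List.replicate_succ]
    set σ₀ : YRF := { σ with blk := List.replicate B.length true } with hσ₀
    have hb := runs_halfBody₀ v (encList (B ++ R)) ρ σ₀ (by simp [hL, encList_cons_eq_dbl]) hA hw ht hp
      (by simp [hσ₀, hC])
    rw [hlen v (by simp)] at hb
    set ρ₁ : RRF := { ρ with
      L := encList (B ++ R)
      z := true :: false :: ((dbl v).reverse ++ ρ.z)
      o := true :: false :: ((dbl v).reverse ++ ρ.o) } with hρ₁
    set σ₁ : YRF := { σ₀ with blk2 := true :: σ.blk2 } with hσ₁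
    have ih := runs_lowerLoop b B R (Ez ++ [v]) (Eo ++ [v]) ρ₁ σ₁ (by simp [hρ₁]) (fun u hu => hlen u (by simp [hu]))
      (by simp [hρ₁, hA]) (by simp [hρ₁, hw]) (by simp [hρ₁, ht]) (by simp [hρ₁, hp]) (by simp [hσ₁, hσ₀, hC])
      (by simp [hρ₁, hz, outRev_append, dbl]) (by simp [hρ₁, ho, outRev_append, dbl]) (by simp [hσ₁, hσ₀])
    refine (Runs.loop_true hk (by simpa [hσ₀, hρ₁, hσ₁] using hb) ih).of_eq ?_ ?_
    · simp only [hρ₁, hσ₁, hσ₀, List.append_assoc, List.length_cons, List.replicate_succ', List.cons_append,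
        List.nil_append]
    · simp only [List.length_cons]; rw [add_mul, one_mul]; omega

/-- Upper-half entry: read it and the matching buffered lower entry, add, emit, park a token.
[folklore] -/
def halfBody₁ : Com YReg :=
  readItemTo iL iA iw it ;; readItemTo oB2 oC iw it ;; addWords iA oC ip oCy ;; emit iA iz ;; push oBlk2 true

/-- Effect of `halfBody₁` on words of width `b`: `37 b + 27` steps. [folklore] -/
theorem runs_halfBody₁ {b : ℕ} (u v rest rest₂ : List Bool) (ρ : RRF) (σ : YRF)
    (hL : ρ.L = dbl u ++ false :: true :: rest) (hB2 : σ.B2 = dbl v ++ false :: true :: rest₂)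
    (hu : u.length = b) (hv : v.length = b) (hA : ρ.A = []) (hw : ρ.w = []) (ht : ρ.t = [])
    (hp : ρ.p = []) (hC : σ.C = []) (hcy : σ.cy = []) :
    Runs halfBody₁ (est ρ σ) (est { ρ with L := rest, z := true :: false :: ((dbl (addW u v)).reverse ++ ρ.z) }
      { σ with B2 := rest₂, blk2 := true :: σ.blk2 }) (37 * b + 27) := by
  set ρ₁ : RRF := { ρ with L := rest, A := u } with hρ₁
  have h1 : Runs (readItemTo iL iA iw it) (est ρ σ) (est ρ₁ σ) (11 * b + 9) := by
    have h := runs_readItemTo (L := iL) (A := iA) (w := iw) (t := it) (by decide) (by decide) (by decide)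
      (by decide) (by decide) u rest (est ρ σ) (by simp [hL]) (by simp [hw]) (by simp [ht])
    rw [hu] at h
    refine h.of_eq ?_ le_rfl
    simp only [hρ₁]; simp [hA]
  set σ₂ : YRF := { σ with B2 := rest₂, C := v } with hσ₂
  have h2 : Runs (readItemTo oB2 oC iw it) (est ρ₁ σ) (est ρ₁ σ₂) (11 * b + 9) := by
    have h := runs_readItemTo (L := oB2) (A := oC) (w := iw) (t := it) (by decide) (by decide) (by decide)
      (by decide) (by decide) v rest₂ (est ρ₁ σ) (by simp [hB2]) (by simp [hρ₁, hw]) (by simp [hρ₁, ht])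
    rw [hv] at h
    refine h.of_eq ?_ le_rfl
    simp only [hσ₂, hρ₁]; simp [hC]
  set ρ₃ : RRF := { ρ₁ with A := addW u v } with hρ₃
  set σ₃ : YRF := { σ₂ with C := [] } with hσ₃
  have h3 : Runs (addWords iA oC ip oCy) (est ρ₁ σ₂) (est ρ₃ σ₃) (11 * b + 5) := by
    have h := runs_addWords (A := iA) (C := oC) (D := ip) (cy := oCy) (by decide) (by decide) (by decide)
      (by decide) (by decide) (by decide) (est ρ₁ σ₂) (by simp [hρ₁, hp]) (by simp [hσ₂, hcy])
    rw [show (est ρ₁ σ₂ iA).length = b by simp [hρ₁, hu]] at h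
    refine h.of_eq ?_ le_rfl
    simp only [hρ₃, hρ₁, hσ₃, hσ₂]; simp [addW, List.drop_eq_nil_of_le (le_of_eq hv)]
  set ρ₄ : RRF := { ρ₃ with A := [], z := true :: false :: ((dbl (addW u v)).reverse ++ ρ.z) } with hρ₄
  have h4 : Runs (emit iA iz) (est ρ₃ σ₃) (est ρ₄ σ₃) (4 * b + 3) := by
    have h := runs_emit (h := iA) (o := iz) (by decide) (est ρ₃ σ₃)
    rw [show (est ρ₃ σ₃ iA).length = b by simp [hρ₃, addW, hu]] at h
    refine h.of_eq ?_ le_rfl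
    simp only [hρ₄, hρ₃, hρ₁]; simp [dbl]
  set σ₅ : YRF := { σ₃ with blk2 := true :: σ.blk2 } with hσ₅
  have h5 : Runs (push oBlk2 true) (est ρ₄ σ₃) (est ρ₄ σ₅) 1 := Runs.push' (by simp only [hσ₅, hσ₃, hσ₂]; simp)
  refine (h1.seq (h2.seq (h3.seq (h4.seq h5)))).of_eq ?_ (by omega)
  simp only [hρ₄, hρ₃, hρ₁, hσ₅, hσ₃, hσ₂, hA]
  obtain ⟨⟩ := σ; simp only at hC ⊢; simp [hC]

/-- The upper half: per block token one `halfBody₁`, consuming the buffered lower half. [folklore] -/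
theorem runs_upperLoop (b : ℕ) : ∀ (U B R Ez : List (List Bool)) (ρ : RRF) (σ : YRF),
    ρ.L = encList (U ++ R) → σ.B2 = encList B → B.length = U.length → (∀ u ∈ U, u.length = b) →
    (∀ v ∈ B, v.length = b) → ρ.A = [] → ρ.w = [] → ρ.t = [] → ρ.p = [] → σ.C = [] → σ.cy = [] →
    ρ.z = outRev Ez → σ.blk = List.replicate U.length true →
    Runs (countLoop oBlk halfBody₁) (est ρ σ)
      (est { ρ with L := encList R, z := outRev (Ez ++ List.zipWith addW U B) }
        { σ with B2 := [], blk := [], blk2 := List.replicate U.length true ++ σ.blk2 })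
      (U.length * (37 * b + 29) + 1)
  | [], B, R, Ez, ρ, σ, hL, hB2, hBU, hlu, hlv, hA, hw, ht, hp, hC, hcy, hz, hblk => by
    have hB : B = [] := List.eq_nil_of_length_eq_zero (by simpa using hBU)
    subst hB
    refine (Runs.loop_nil _ _ (by simpa using hblk)).of_eq ?_ (by simp)
    obtain ⟨⟩ := ρ; obtain ⟨⟩ := σ; simp only at hL hz hB2 hblk ⊢; simp [hL, hz, hB2, hblk]
  | u :: U, B, R, Ez, ρ, σ, hL, hB2, hBU, hlu, hlv, hA, hw, ht, hp, hC, hcy, hz, hblk => by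
    obtain ⟨v, B, rfl⟩ : ∃ v B', B = v :: B' := by
      cases B with
      | nil => simp at hBU
      | cons v B' => exact ⟨v, B', rfl⟩
    have hk : est ρ σ oBlk = true :: List.replicate U.length true := by simp [hblk, List.replicate_succ]
    set σ₀ : YRF := { σ with blk := List.replicate U.length true } with hσ₀
    have hb := runs_halfBody₁ (b := b) u v (encList (U ++ R)) (encList B) ρ σ₀ (by simp [hL, encList_cons_eq_dbl])
      (by simp [hσ₀, hB2, encList_cons_eq_dbl]) (hlu u (by simp)) (hlv v (by simp)) hA hw ht hp (by simp [hσ₀, hC])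
      (by simp [hσ₀, hcy])
    set ρ₁ : RRF := { ρ with L := encList (U ++ R), z := true :: false :: ((dbl (addW u v)).reverse ++ ρ.z) } with hρ₁
    set σ₁ : YRF := { σ₀ with B2 := encList B, blk2 := true :: σ.blk2 } with hσ₁
    have ih := runs_upperLoop b U B R (Ez ++ [addW u v]) ρ₁ σ₁ (by simp [hρ₁]) (by simp [hσ₁])
      (by simpa using hBU) (fun x hx => hlu x (by simp [hx])) (fun x hx => hlv x (by simp [hx]))
      (by simp [hρ₁, hA]) (by simp [hρ₁, hw]) (by simp [hρ₁, ht]) (by simp [hρ₁, hp]) (by simp [hσ₁, hσ₀, hC])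
      (by simp [hσ₁, hσ₀, hcy]) (by simp [hρ₁, hz, outRev_append, dbl]) (by simp [hσ₁, hσ₀])
    refine (Runs.loop_true hk (by simpa [hσ₀, hρ₁, hσ₁] using hb) ih).of_eq ?_ ?_
    · simp only [hρ₁, hσ₁, hσ₀, List.zipWith_cons_cons, List.append_assoc, List.length_cons, List.replicate_succ',
        List.cons_append, List.nil_append]
    · simp only [List.length_cons]; rw [add_mul, one_mul]; omega

/-- `pairBody`: one chunk — buffer the lower half, replay it against the upper half. [folklore] -/
def pairBody : Com YReg :=
  countLoop oBlk halfBody₀ ;; (pour oBlk2 oBlk ;; pour io oB2) ;; countLoop oBlk halfBody₁ ;; pour oBlk2 oBlk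

/-- The cost of a chunk of `2k` words of width `b`. [folklore] -/
def pairCost (k b : ℕ) : ℕ :=
  (k * (29 * b + 21) + 1) + (3 * k + 1 + (3 * (k * (2 * b + 2)) + 1)) + (k * (37 * b + 29) + 1) + (3 * k + 1)

/-- **Effect of `pairBody`** on a chunk `B ++ U` (`|B| = |U| = k`, the block counter holding
`1ᵏ`): the words `B ++ zipWith addW U B` are emitted onto `z`. [cite: Williams2014, Lemma 4.2 (Proof 2)] -/
theorem runs_pairBody {k b : ℕ} (B U R Ez : List (List Bool)) (ρ : RRF) (σ : YRF)
    (hL : ρ.L = encList (B ++ U ++ R)) (hB : B.length = k) (hU : U.length = k)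
    (hlB : ∀ v ∈ B, v.length = b) (hlU : ∀ u ∈ U, u.length = b) (hA : ρ.A = []) (hw : ρ.w = [])
    (ht : ρ.t = []) (hp : ρ.p = []) (ho : ρ.o = []) (hz : ρ.z = outRev Ez) (hC : σ.C = []) (hcy : σ.cy = [])
    (hB2 : σ.B2 = []) (hblk : σ.blk = List.replicate k true) (hblk2 : σ.blk2 = []) :
    Runs pairBody (est ρ σ) (est { ρ with L := encList R, z := outRev (Ez ++ B ++ List.zipWith addW U B) } σ)
      (pairCost k b) := by
  -- lower half
  have h1 := runs_lowerLoop b B (U ++ R) Ez [] ρ σ (by simp [hL]) hlB hA hw ht hp hC hz (by simp [ho])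
    (by simp [hblk, hB])
  rw [hB] at h1
  set ρ₁ : RRF := { ρ with L := encList (U ++ R), z := outRev (Ez ++ B), o := outRev ([] ++ B) } with hρ₁
  set σ₁ : YRF := { σ with blk := [], blk2 := List.replicate k true ++ σ.blk2 } with hσ₁
  -- restore the counter, make the buffer forward
  set σ₂ : YRF := { σ with blk := List.replicate k true, blk2 := [], B2 := encList B } with hσ₂
  set ρ₂ : RRF := { ρ₁ with o := [] } with hρ₂
  have h2 : Runs (pour oBlk2 oBlk ;; pour io oB2) (est ρ₁ σ₁) (est ρ₂ σ₂) (3 * k + 1 + (3 * (k * (2 * b + 2)) + 1)) := by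
    have e1 := runs_pour (a := oBlk2) (b := oBlk) (by decide) (est ρ₁ σ₁)
    rw [show (est ρ₁ σ₁ oBlk2).length = k by simp [hσ₁, hblk2]] at e1
    set σ' : YRF := { σ₁ with blk := List.replicate k true, blk2 := [] } with hσ'
    have e1' : Runs (pour oBlk2 oBlk) (est ρ₁ σ₁) (est ρ₁ σ') (3 * k + 1) := by
      refine e1.of_eq ?_ le_rfl
      simp only [hσ', hσ₁]; simp [hblk2]
    have e2 := runs_pour (a := io) (b := oB2) (by decide) (est ρ₁ σ')
    have hlen : (est ρ₁ σ' io).length = k * (2 * b + 2) := by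
      simp only [Sum.elim_inl, regs_o, hρ₁, List.nil_append, Radix.length_outRev]
      rw [List.map_congr_left (fun v hv => by rw [hlB v hv] : ∀ v ∈ B, 2 * v.length + 2 = 2 * b + 2),
        List.map_const', List.sum_replicate, smul_eq_mul, hB]
    rw [hlen] at e2
    refine (e1'.seq e2).of_eq ?_ le_rfl
    simp only [hσ₂, hσ', hσ₁, hρ₂, hρ₁]; simp [hB2, reverse_outRev]
  -- upper half
  have h3 := runs_upperLoop b U B R (Ez ++ B) ρ₂ σ₂ (by simp [hρ₂, hρ₁]) (by simp [hσ₂]) (by rw [hB, hU]) hlU hlB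
    (by simp [hρ₂, hρ₁, hA]) (by simp [hρ₂, hρ₁, hw]) (by simp [hρ₂, hρ₁, ht]) (by simp [hρ₂, hρ₁, hp])
    (by simp [hσ₂, hC]) (by simp [hσ₂, hcy]) (by simp [hρ₂, hρ₁]) (by simp [hσ₂, hU])
  rw [hU] at h3
  set ρ₃ : RRF := { ρ₂ with L := encList R, z := outRev (Ez ++ B ++ List.zipWith addW U B) } with hρ₃
  set σ₃ : YRF := { σ₂ with B2 := [], blk := [], blk2 := List.replicate k true ++ σ₂.blk2 } with hσ₃
  -- restore the counter
  have h4 : Runs (pour oBlk2 oBlk) (est ρ₃ σ₃) (est ρ₃ σ) (3 * k + 1) := by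
    have h := runs_pour (a := oBlk2) (b := oBlk) (by decide) (est ρ₃ σ₃)
    rw [show (est ρ₃ σ₃ oBlk2).length = k by simp [hσ₃, hσ₂]] at h
    refine h.of_eq ?_ le_rfl
    simp only [hσ₃, hσ₂]; obtain ⟨⟩ := σ; simp only at hblk hblk2 hB2 ⊢; simp [hblk, hblk2, hB2]
  have H := (h1.of_eq (by simp only [hρ₁, hσ₁]) le_rfl).seq (h2.seq ((h3.of_eq (by simp only [hρ₃, hσ₃]) le_rfl).seq h4))
  refine H.of_eq ?_ (by unfold pairCost; omega)
  simp only [hρ₃, hρ₂, hρ₁, ho]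

/-! ### Phase 4: a round over all chunks -/

/-- Peeling the LAST chunk of a blockwise round. [folklore] -/
theorem blockRoundW_snoc (k : ℕ) : ∀ (m : ℕ) (X c : List (List Bool)), X.length = m * (2 * k) → c.length = 2 * k →
    blockRoundW k (m + 1) (X ++ c) =
      blockRoundW k m X ++ (c.take k ++ List.zipWith addW ((c.drop k).take k) (c.take k))
  | 0, X, c, hX, hc => by
    have : X = [] := List.eq_nil_of_length_eq_zero (by simpa using hX)
    subst this
    simp [blockRoundW]
  | m + 1, X, c, hX, hc => by
    have hX2 : 2 * k ≤ X.length := by rw [hX]; nlinarith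
    have hXk : k ≤ X.length := by omega
    have hXdk : k ≤ (X.drop k).length := by rw [List.length_drop]; omega
    rw [blockRoundW, List.take_append_of_le_length hXk, List.drop_append_of_le_length hXk,
      List.take_append_of_le_length hXdk, List.drop_append_of_le_length hX2,
      blockRoundW_snoc k m (X.drop (2 * k)) c (by rw [List.length_drop, hX]; ring_nf; omega) hc]
    conv_rhs => rw [blockRoundW]
    simp [List.append_assoc]

/-- Sums of words of width `b` have width `b`. [folklore] -/
theorem length_of_mem_zipWith_addW {b : ℕ} : ∀ (U B : List (List Bool)), (∀ u ∈ U, u.length = b) →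
    ∀ v ∈ List.zipWith addW U B, v.length = b
  | [], _, _, v, hv => by simp at hv
  | _ :: _, [], _, v, hv => by simp at hv
  | u :: U, w :: B, hU, v, hv => by
    rw [List.zipWith_cons_cons, List.mem_cons] at hv
    rcases hv with rfl | hv
    · rw [addW, length_addBits]; exact hU u (by simp)
    · exact length_of_mem_zipWith_addW U B (fun x hx => hU x (by simp [hx])) v hv

/-- The words of a blockwise round keep their width. [folklore] -/
theorem length_of_mem_blockRoundW {k b : ℕ} : ∀ (m : ℕ) (l : List (List Bool)), (∀ v ∈ l, v.length = b) →
    ∀ v ∈ blockRoundW k m l, v.length = b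
  | 0, l, _, v, hv => by simp [blockRoundW] at hv
  | m + 1, l, hl, v, hv => by
    simp only [blockRoundW, List.mem_append] at hv
    rcases hv with (hv | hv) | hv
    · exact hl v (List.mem_of_mem_take hv)
    · exact length_of_mem_zipWith_addW _ _ (fun u hu => hl u (List.mem_of_mem_drop (List.mem_of_mem_take hu))) v hv
    · exact length_of_mem_blockRoundW m _ (fun u hu => hl u (List.mem_of_mem_drop hu)) v hv

/-- The length of a blockwise round on full chunks. [folklore] -/
theorem length_blockRoundW (k : ℕ) : ∀ (m : ℕ) (l : List (List Bool)), l.length = m * (2 * k) →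
    (blockRoundW k m l).length = l.length
  | 0, l, h => by rw [Nat.zero_mul] at h; simp [blockRoundW, h]
  | m + 1, l, h => by
    have hlen : l.length = m * (2 * k) + 2 * k := by rw [h]; ring
    simp only [blockRoundW, List.length_append, List.length_take, List.length_zipWith, List.length_drop]
    rw [length_blockRoundW k m _ (by rw [List.length_drop]; omega), List.length_drop]
    omega

/-- The chunks of a table, each as (first word, remaining words) so that chunks are visibly
nonempty. [folklore] -/
def chunks (k : ℕ) : ℕ → List (List Bool) → List (List Bool × List (List Bool))
  | 0, _ => []
  | m + 1, l => (l.headD [], (l.take (2 * k)).tail) :: chunks k m (l.drop (2 * k))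

/-- The words of a chunk. [folklore] -/
def chunkWords (c : List Bool × List (List Bool)) : List (List Bool) := c.1 :: c.2

/-- The chunks reassemble the table. [folklore] -/
theorem flatMap_chunks {k : ℕ} (hk : 0 < k) : ∀ (m : ℕ) (l : List (List Bool)), l.length = m * (2 * k) →
    (chunks k m l).flatMap chunkWords = l ∧ ∀ c ∈ chunks k m l, (chunkWords c).length = 2 * k
  | 0, l, h => by
    rw [Nat.zero_mul] at h
    exact ⟨by simp [chunks, List.eq_nil_of_length_eq_zero h], by simp [chunks]⟩
  | m + 1, l, h => by
    have hlen : l.length = m * (2 * k) + 2 * k := by rw [h]; ring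
    obtain ⟨w, l', rfl⟩ : ∃ w l', l = w :: l' := by
      cases l with
      | nil => simp at hlen; omega
      | cons w l' => exact ⟨w, l', rfl⟩
    obtain ⟨ih1, ih2⟩ := flatMap_chunks hk m ((w :: l').drop (2 * k)) (by rw [List.length_drop]; omega)
    have htake : chunkWords (((w :: l').headD [], ((w :: l').take (2 * k)).tail)) = (w :: l').take (2 * k) := by
      obtain ⟨k', hk'⟩ : ∃ k', 2 * k = k' + 1 := ⟨2 * k - 1, by omega⟩
      rw [hk']; simp [chunkWords]
    refine ⟨?_, ?_⟩
    · rw [chunks, List.flatMap_cons, ih1, htake, List.take_append_drop]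
    · intro c hc
      rw [chunks, List.mem_cons] at hc
      rcases hc with rfl | hc
      · rw [htake, List.length_take]; omega
      · exact ih2 c hc

/-- There are `m` chunks. [folklore] -/
@[simp] theorem length_chunks (k : ℕ) : ∀ (m : ℕ) (l : List (List Bool)), (chunks k m l).length = m
  | 0, _ => rfl
  | m + 1, l => by simp [chunks, length_chunks k m]

/-- `roundProg`: the pair body over all chunks, the emitted table poured back onto `L`. [folklore] -/
def roundProg : Com YReg := streamLoop iL iw pairBody ;; pour iz iL

/-- **Effect of a round** on a table of `m` chunks of `2k` words of width `b` (block counter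
`1ᵏ`): `L := encList (blockRoundW k m W)`. [cite: Williams2014, Lemma 4.2 (Proof 2)] -/
theorem runs_roundProg {k b m : ℕ} (hk : 0 < k) (W : List (List Bool)) (hW : W.length = m * (2 * k))
    (hlW : ∀ v ∈ W, v.length = b) (ρ : RRF) (σ : YRF) (hL : ρ.L = encList W) (hA : ρ.A = [])
    (hw : ρ.w = []) (ht : ρ.t = []) (hp : ρ.p = []) (ho : ρ.o = []) (hz : ρ.z = []) (hC : σ.C = [])
    (hcy : σ.cy = []) (hB2 : σ.B2 = []) (hblk : σ.blk = List.replicate k true) (hblk2 : σ.blk2 = []) :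
    Runs roundProg (est ρ σ) (est { ρ with L := encList (blockRoundW k m W) } σ)
      (m * pairCost k b + 6 * m + 4 + (3 * (m * (2 * k) * (2 * b + 2)) + 1)) := by
  obtain ⟨hflat, hchunk⟩ := flatMap_chunks hk m W hW
  set CH := chunks k m W with hCH
  let P : List (List Bool × List (List Bool)) → Regs YReg → Prop := fun l R => ∃ done, CH = done ++ l ∧
    R = est { ρ with
      L := encList (l.flatMap chunkWords)
      z := outRev (blockRoundW k done.length (done.flatMap chunkWords)) } σ
  have hbody : ∀ (a : List Bool × List (List Bool)) (l : List (List Bool × List (List Bool))) (R : Regs YReg),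
      P (a :: l) R → R iL = encList ((a :: l).flatMap chunkWords) → R iw = [] →
      ∃ R', Runs pairBody R R' (pairCost k b) ∧ R' iL = encList (l.flatMap chunkWords) ∧ R' iw = [] ∧ P l R' := by
    rintro a l R ⟨done, hdone, rfl⟩ - -
    have ha : a ∈ CH := by rw [hdone]; simp
    have hal : (chunkWords a).length = 2 * k := hchunk a ha
    have hmem : ∀ v ∈ chunkWords a, v ∈ W := fun v hv => by
      rw [← hflat]; exact List.mem_flatMap.2 ⟨a, ha, hv⟩
    set B := (chunkWords a).take k with hB
    set U := (chunkWords a).drop k with hU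
    have hBU : chunkWords a = B ++ U := (List.take_append_drop k _).symm
    have hBl : B.length = k := by rw [hB, List.length_take]; omega
    have hUl : U.length = k := by rw [hU, List.length_drop]; omega
    have hdl : (done.flatMap chunkWords).length = done.length * (2 * k) := by
      rw [List.length_flatMap]
      rw [List.map_congr_left (fun c hc => hchunk c (by rw [hdone]; simp [hc]) : ∀ c ∈ done, (chunkWords c).length = 2 * k),
        List.map_const', List.sum_replicate, smul_eq_mul]
    refine ⟨_, runs_pairBody (k := k) (b := b) B U (l.flatMap chunkWords)
      (blockRoundW k done.length (done.flatMap chunkWords)) _ σ (by simp [hBU, List.append_assoc]) hBl hUl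
      (fun v hv => hlW v (hmem v (by rw [hBU]; simp [hv]))) (fun u hu => hlW u (hmem u (by rw [hBU]; simp [hu])))
      (by simp [hA]) (by simp [hw]) (by simp [ht]) (by simp [hp]) (by simp [ho]) (by simp) hC hcy hB2 hblk hblk2,
      by simp, by simp [hw], done ++ [a], by simp [hdone], ?_⟩
    · simp only [List.length_append, List.length_singleton, List.flatMap_append, List.flatMap_cons,
        List.flatMap_nil, List.append_nil]
      rw [blockRoundW_snoc k done.length _ _ hdl hal, ← hB, ← hU, show U.take k = U from
        List.take_of_length_le (le_of_eq hUl)]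
      simp [List.append_assoc]
  obtain ⟨R', hloop, -, -, ⟨done, hdone, rfl⟩⟩ := runs_streamLoop (L := iL) (w := iw) (by decide)
    (fun l => encList (l.flatMap chunkWords)) rfl (fun a l => by simpa [chunkWords] using encList_cons_ne_nil _ _)
    P (fun _ => pairCost k b) hbody CH (est ρ σ)
    ⟨[], by simp, by obtain ⟨⟩ := ρ; simp only at hL hz ⊢; simp [hL, hz, hflat, blockRoundW]⟩
    (by simp [hL, hflat]) (by simp [hw])
  rw [List.append_nil] at hdone
  subst hdone
  rw [hflat] at hloop
  simp only [List.map_const', List.sum_replicate, smul_eq_mul, hCH, length_chunks, List.flatMap_nil] at hloop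
  have h2 := runs_pour (a := iz) (b := iL) (by decide) (est { ρ with L := encList [], z := outRev (blockRoundW k m W) } σ)
  have hlen : (est { ρ with L := encList [], z := outRev (blockRoundW k m W) } σ iz).length = m * (2 * k) * (2 * b + 2) := by
    simp only [Sum.elim_inl, regs_z, Radix.length_outRev]
    rw [List.map_congr_left (fun v hv => by rw [length_of_mem_blockRoundW m W hlW v hv] :
      ∀ v ∈ blockRoundW k m W, 2 * v.length + 2 = 2 * b + 2), List.map_const', List.sum_replicate, smul_eq_mul,
      length_blockRoundW k m W hW, hW]
  rw [hlen] at h2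
  refine (hloop.seq h2).of_eq ?_ le_rfl
  simp [reverse_outRev, hz]

/-! ### Phase 4: the `n` rounds -/

/-- `pairCost` in closed form. [folklore] -/
theorem pairCost_eq (k b : ℕ) : pairCost k b = k * (72 * b + 62) + 5 := by unfold pairCost; ring

/-- A uniform bound for one round on a table of `2ⁿ` words of width `b`. [folklore] -/
def roundBound (n b : ℕ) : ℕ := 2 ^ n * (78 * b + 79) + 5

/-- A uniform bound for the body of the round loop. [folklore] -/
def zetaBody (n b : ℕ) : ℕ := roundBound n b + (7 * 2 ^ n + 2) + 1

/-- A uniform bound for one iteration of the round loop. [folklore] -/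
def zetaIter (n b : ℕ) : ℕ := zetaBody n b + 2

/-- **The rounds compute `gTable`**: `k` more rounds from round `j` (`j + k = n`), the block
counter doubling, the round counter `N` parked on `N2`. [cite: Williams2014, Lemma 4.2 (Proof 2)] -/
theorem runs_zetaLoop {n : ℕ} (S : SymPlus n) (b : ℕ) : ∀ (k j : ℕ) (ρ : RRF) (σ : YRF), j + k = n →
    ρ.L = encList ((gTable S j).map (natToWord b)) → ρ.A = [] → ρ.w = [] → ρ.t = [] → ρ.p = [] → ρ.o = [] →
    ρ.z = [] → σ.C = [] → σ.cy = [] → σ.B2 = [] → σ.blk = List.replicate (2 ^ j) true → σ.blk2 = [] →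
    σ.N = List.replicate k true → σ.N2 = List.replicate j true →
    Runs (countLoop oN (roundProg ;; dblUnary oBlk oBlk2 ;; push oN2 true)) (est ρ σ)
      (est { ρ with L := encList ((gTable S n).map (natToWord b)) }
        { σ with blk := List.replicate (2 ^ n) true, N := [], N2 := List.replicate n true })
      (k * zetaIter n b + 1)
  | 0, j, ρ, σ, hjk, hL, hA, hw, ht, hp, ho, hz, hC, hcy, hB2, hblk, hblk2, hN, hN2 => by
    rw [Nat.add_zero] at hjk; subst hjk
    refine (Runs.loop_nil _ _ (by simpa using hN)).of_eq ?_ (by simp)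
    obtain ⟨⟩ := ρ; obtain ⟨⟩ := σ; simp only at hL hblk hN hN2 ⊢; simp [hL, hblk, hN, hN2]
  | k + 1, j, ρ, σ, hjk, hL, hA, hw, ht, hp, ho, hz, hC, hcy, hB2, hblk, hblk2, hN, hN2 => by
    have hj : j < n := by omega
    have hk : est ρ σ oN = true :: List.replicate k true := by simp [hN, List.replicate_succ]
    set σ₀ : YRF := { σ with N := List.replicate k true } with hσ₀
    set m := 2 ^ n / 2 ^ (j + 1) with hm
    have hchunks : (2 ^ n : ℕ) = m * (2 * 2 ^ j) := two_pow_eq_chunks hj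
    have hm_le : m ≤ 2 ^ n := Nat.div_le_self _ _
    have hmk : m * 2 ^ j ≤ 2 ^ n := by rw [hchunks]; nlinarith
    -- the round
    have hr := runs_roundProg (k := 2 ^ j) (b := b) (m := m) (Nat.two_pow_pos j) ((gTable S j).map (natToWord b))
      (by rw [List.length_map, length_gTable, hchunks]) (fun v hv => by
        rw [List.mem_map] at hv; obtain ⟨x, -, rfl⟩ := hv; exact length_natToWord b x)
      ρ σ₀ hL hA hw ht hp ho hz (by simp [hσ₀, hC]) (by simp [hσ₀, hcy]) (by simp [hσ₀, hB2]) (by simp [hσ₀, hblk])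
      (by simp [hσ₀, hblk2])
    rw [blockRoundW_map, show blockRound (2 ^ j) m (gTable S j) = gTable S (j + 1) by rw [gTable, if_pos hj]] at hr
    have hrcost : m * pairCost (2 ^ j) b + 6 * m + 4 + (3 * (m * (2 * 2 ^ j) * (2 * b + 2)) + 1) ≤ roundBound n b := by
      rw [pairCost_eq, ← hchunks, roundBound]
      have e1 : m * (2 ^ j * (72 * b + 62) + 5) = m * 2 ^ j * (72 * b + 62) + 5 * m := by ring
      have e2 : m * 2 ^ j * (72 * b + 62) ≤ 2 ^ n * (72 * b + 62) := Nat.mul_le_mul_right _ hmk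
      have e3 : 2 ^ n * (78 * b + 79) = 2 ^ n * (72 * b + 62) + 5 * 2 ^ n + 6 * 2 ^ n + 3 * (2 ^ n * (2 * b + 2)) := by ring
      rw [e1, e3]
      have := Nat.mul_le_mul_left 5 hm_le
      have := Nat.mul_le_mul_left 6 hm_le
      omega
    set ρ₁ : RRF := { ρ with L := encList ((gTable S (j + 1)).map (natToWord b)) } with hρ₁
    -- double the block counter, park a round token
    set σ₂ : YRF := { σ₀ with blk := List.replicate (2 ^ (j + 1)) true } with hσ₂
    have hd : Runs (dblUnary oBlk oBlk2) (est ρ₁ σ₀) (est ρ₁ σ₂) (7 * 2 ^ n + 2) := by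
      have h := runs_dblUnary (N := oBlk) (N2 := oBlk2) (by decide) (2 ^ j) (est ρ₁ σ₀) (by simp [hσ₀, hblk])
        (by simp [hσ₀, hblk2])
      refine h.of_eq ?_ ?_
      · simp only [hσ₂, hσ₀, pow_succ']; simp
      · have : 2 ^ j ≤ 2 ^ n := Nat.pow_le_pow_right two_pos hj.le
        omega
    set σ₃ : YRF := { σ₂ with N2 := List.replicate (j + 1) true } with hσ₃
    have hpush : Runs (push oN2 true) (est ρ₁ σ₂) (est ρ₁ σ₃) 1 :=
      Runs.push' (by simp only [hσ₃, hσ₂, hσ₀]; simp [hN2, List.replicate_succ])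
    have hbody : Runs (roundProg ;; dblUnary oBlk oBlk2 ;; push oN2 true) (Function.update (est ρ σ) oN (List.replicate k true))
        (est ρ₁ σ₃) (zetaBody n b) := by
      have e := (hr.mono hrcost).seq (hd.seq hpush)
      have e' : Runs (roundProg ;; dblUnary oBlk oBlk2 ;; push oN2 true) (est ρ σ₀) (est ρ₁ σ₃) (zetaBody n b) :=
        e.of_eq rfl (by unfold zetaBody; omega)
      simpa [hσ₀] using e'
    have ih := runs_zetaLoop S b k (j + 1) ρ₁ σ₃ (by omega) (by simp [hρ₁]) hA hw ht hp ho hz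
      (by simp [hσ₃, hσ₂, hσ₀, hC]) (by simp [hσ₃, hσ₂, hσ₀, hcy]) (by simp [hσ₃, hσ₂, hσ₀, hB2]) (by simp [hσ₃, hσ₂])
      (by simp [hσ₃, hσ₂, hσ₀, hblk2]) (by simp [hσ₃, hσ₂, hσ₀]) (by simp [hσ₃])
    refine (Runs.loop_true hk hbody ih).of_eq ?_ ?_
    · simp only [hρ₁, hσ₃, hσ₂, hσ₀]
    · rw [add_mul, one_mul, zetaIter]; omega

/-- `zetaProg`: block counter `1`, `n` rounds (restoring `N`), drop the block counter. [folklore] -/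
def zetaProg : Com YReg :=
  push oBlk true ;; countLoop oN (roundProg ;; dblUnary oBlk oBlk2 ;; push oN2 true) ;; pour oN2 oN ;; clear oBlk

/-- The cost of the zeta phase. [folklore] -/
def zetaCost (n b : ℕ) : ℕ := 1 + (n * zetaIter n b + 1) + (3 * n + 1) + (2 * 2 ^ n + 1)

/-- **Effect of the zeta phase**: the multiplicity table becomes the table after `n` rounds,
`gTable S n` — entry `T` the number of terms true at the `T`-th assignment (`getD_gTable_n`).
[cite: Williams2014, Lemma 4.2 (Proof 2)] -/
theorem runs_zetaProg {n : ℕ} (S : SymPlus n) (b : ℕ) (ρ : RRF) (σ : YRF)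
    (hL : ρ.L = encList ((fTable S).map (natToWord b))) (hA : ρ.A = []) (hw : ρ.w = []) (ht : ρ.t = [])
    (hp : ρ.p = []) (ho : ρ.o = []) (hz : ρ.z = []) (hC : σ.C = []) (hcy : σ.cy = []) (hB2 : σ.B2 = [])
    (hblk : σ.blk = []) (hblk2 : σ.blk2 = []) (hN : σ.N = List.replicate n true) (hN2 : σ.N2 = []) :
    Runs zetaProg (est ρ σ) (est { ρ with L := encList ((gTable S n).map (natToWord b)) } σ) (zetaCost n b) := by
  set σ₁ : YRF := { σ with blk := [true] } with hσ₁
  have h1 : Runs (push oBlk true) (est ρ σ) (est ρ σ₁) 1 := Runs.push' (by simp only [hσ₁]; simp [hblk])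
  have h2 := runs_zetaLoop S b n 0 ρ σ₁ (by omega) (by simpa [gTable] using hL) hA hw ht hp ho hz (by simp [hσ₁, hC])
    (by simp [hσ₁, hcy]) (by simp [hσ₁, hB2]) (by simp [hσ₁]) (by simp [hσ₁, hblk2]) (by simp [hσ₁, hN])
    (by simp [hσ₁, hN2])
  set ρ₂ : RRF := { ρ with L := encList ((gTable S n).map (natToWord b)) } with hρ₂
  set σ₂ : YRF := { σ₁ with blk := List.replicate (2 ^ n) true, N := [], N2 := List.replicate n true } with hσ₂
  set σ₃ : YRF := { σ₂ with N := List.replicate n true, N2 := [] } with hσ₃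
  have h3 : Runs (pour oN2 oN) (est ρ₂ σ₂) (est ρ₂ σ₃) (3 * n + 1) := by
    have h := runs_pour (a := oN2) (b := oN) (by decide) (est ρ₂ σ₂)
    rw [show (est ρ₂ σ₂ oN2).length = n by simp [hσ₂]] at h
    refine h.of_eq ?_ le_rfl
    simp only [hσ₃, hσ₂]; simp
  have h4 : Runs (clear oBlk) (est ρ₂ σ₃) (est ρ₂ σ) (2 * 2 ^ n + 1) := by
    have h := runs_clear oBlk (est ρ₂ σ₃)
    rw [show (est ρ₂ σ₃ oBlk).length = 2 ^ n by simp [hσ₃, hσ₂]] at h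
    refine h.of_eq ?_ le_rfl
    simp only [hσ₃, hσ₂, hσ₁]; obtain ⟨⟩ := σ; simp only at hblk hN hN2 ⊢; simp [hblk, hN, hN2]
  have H := h1.seq ((h2.of_eq (by simp only [hρ₂, hσ₂]) le_rfl).seq (h3.seq h4))
  exact H.of_eq (by simp only [hρ₂]) (by unfold zetaCost; omega)

end YatesM

end Literature.Computability.Complexity
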